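import Literature.NumberTheory.EllipticCurves.TunnellThmTwoOrdinaryProofs
import HarnessLib

/-!
# The congruent-number newform as a theta product: `φ = (2gθ₃₂ - gθ₈)(2θ₁₆ - θ₄) ∈ S₂(Γ₀(128))`
# with `a_N(φ) = a_N(E)`, and `a_N(E_n) = (n/N) a_N(φ)`

The weight-`2` newform `φ = η(4z)²η(8z)² = q - 2q⁵ - 3q⁹ + 6q¹³ + 2q¹⁷ - …` of the congruent
number curve `E : y² = x³ - x` (Tunnell 1983, p. 325: "`φ`, the unique normalized newform of weight
`2`, level `32` … whose Mellin transform is `L(E, s)`"; and "`L(E^D, s)` is the Mellin transform of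
`φ ⊗ χ_D`") is the weight-`2` form that Shintani's theta lift must be applied to in the explicit route
to Waldspurger's relation (`Literature.NumberTheory.EllipticCurves.Tunnell1983_a_sq_propto_L_one`; endgame
`TunnellWaldspurgerSymmetricFamilyProofs`, hypothesis (H3): the diagonal coefficients are periods of
`φ ⊗ χ_D`, i.e. `L(E_D, 1)`). The tree proved Tunnell's Theorem 2 by matching Hecke eigenvalues with
`a_p(E)` through Jacobi sums, never constructing `φ` itself as a modular form. This file supplies it,
inside the tree's framework of Tunnell's theta series (`S_{4/2}(128, 1) = S₂(Γ₀(128))`,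
`TunnellWeightTwoThetaProductsProofs.toCuspFormTwo`), and PROVES that its `q`-expansion is the
`L`-series of `E` and of all its quadratic twists:

* `sum_dupL_eq_sum_dupR`, `sq_two_thirtytwo_sub_eight` — **the duplication identity
  `(2θ₃₂ - θ₈)² = θ₃(8z) θ₄(8z)`** (`θ₄(2τ)² = θ₃(τ)θ₄(τ)` at `τ = 8z`), coefficientwise:
  `∑_{8k²+8l²=N} (-1)^{k+l} = ∑_{4a²+4b²=N} (-1)^b` — pairs with `a ≢ b (2)` cancel under `(a,b) ↦ (b,a)`
  and `(k,l) ↦ (k+l, k-l)` is a bijection onto `a ≡ b (2)`;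
* `two_thirtytwo_sub_eight_eq_half_theta1'` — **`2gθ₃₂ - gθ₈ = ½ θ₁'(8z)`** (`= η(8z)³ =
  ∑ χ₋₄(m) m q^{m²}`, Tunnell's remark p. 327), from the tree's `2g = (θ₁ - θ₄)(2θ₃₂ - θ₈)`
  (`two_mul_tunnellG_eq`), `θ₂(8z) = θ₁ - θ₄` (`theta2_eight_eq_one_sub_four`), the duplication identity
  and Jacobi's `θ₁' = θ₂θ₃θ₄` (`JacobiThetaNull.jacobi_derivative_formula`, tree); also
  `theta3_eight_eq_thetaMul_four`, `theta4_eight_eq` (`θ₄(8z) = 2θ₁₆ - θ₄`);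
* `congruentPhi` — **`φ := (2gθ₃₂ - gθ₈)·(2θ₁₆ - θ₄)`**, `congruentPhi_mem : φ ∈ S_{4/2}(128, 1)`
  (products of `S_{3/2}(128,1)` with `θ₄, θ₁₆`, tree's `mul_thetaMul_mem_of_mem_triv`), and
  `congruentPhi_eq_half_theta1'_mul_theta4 : φ = ½ θ₁'(8z) θ₄(8z)`;
* `hasSum_congruentPhi`, `qCoeffs_congruentPhi` — **`φ = ∑_N Re S(N) qᴺ`**, `S(N) = ∑_{x primary, N x = N} x`
  (`GaussianPrimary.primarySum`): the double series `½ ∑ (-1)^{n+b}(2n+1) q^{(2n+1)²+4b²}` regrouped by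
  the exponent is `½ · (pair sum) = Re S(N)` by the tree's `pairSum_eq_two_mul_re_primarySum`;
* `qCoeffs_congruentPhi_eq_lFunction` — **`a_N(φ) = a_N(E)` for all `N ≥ 1`**
  (`E = congruentNumberCurve 1`; `a_N(E) = Re S(N)` is the tree's
  `lFunction_congruentNumberCurve_eq_jacobiSym_mul_primarySum` with `IrelandRosen1990_…_holds`);
* `lFunction_congruentNumberCurve_eq_jacobiSym_mul_qCoeffs` — **`a_N(E_n) = (n/N) · a_N(φ)`** for
  square-free `n`, `N ≥ 1` (Jacobi symbol): the `L`-series of every quadratic twist `E_n` is the twist of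
  the `q`-expansion of `φ`.

Numerically: `φ = q - 2q⁵ - 3q⁹ + 6q¹³ + 2q¹⁷ - q²⁵ - 10q²⁹ - 2q³⁷ + …` (= `η(4z)²η(8z)²` through `q²⁰⁰`).
No named facts; the definitions are the solution sets `box2/dupL/dupR`, the terms `termE` and `congruentPhi`.

## References

* J. B. Tunnell, *A classical Diophantine problem and modular forms of weight 3/2*, Invent. Math.
  72 (1983) 323–334, p. 325 (`φ`, `L(E^D, s)`), p. 327 (the theta series, Remark). [Tunnell1983Congruent]
* N. Koblitz, *Introduction to Elliptic Curves and Modular Forms*, GTM 97, Ch. II §5, Ch. IV §4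
  (`L(E_n, s)` as a Hecke `L`-series; the CM form). [KoblitzECMF1993]
* K. Ireland, M. Rosen, *A Classical Introduction to Modern Number Theory*, Ch. 18 §4–6. [IrelandRosen1990]
-/

noncomputable section

open Complex Real Finset Function
open Literature.NumberTheory.EllipticCurves.JacobiThetaNull
open Literature.NumberTheory.EllipticCurves.ModularForms
open scoped UpperHalfPlane

namespace Literature.NumberTheory.EllipticCurves.Tunnell1983

/-! ### The duplication identity `(2θ₃₂ - θ₈)² = θ₃(8z) θ₄(8z)` coefficientwise -/

/-- The box `[-N, N]²`. [folklore] -/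
def box2 (N : ℕ) : Finset (ℤ × ℤ) := Finset.Icc (-(N : ℤ)) N ×ˢ Finset.Icc (-(N : ℤ)) N

/-- Solutions of `8k² + 8l² = N` in the box. [folklore] -/
def dupL (N : ℕ) : Finset (ℤ × ℤ) := (box2 N).filter fun x ↦ 8 * x.1 ^ 2 + 8 * x.2 ^ 2 = (N : ℤ)

/-- Solutions of `4a² + 4b² = N` in the box. [folklore] -/
def dupR (N : ℕ) : Finset (ℤ × ℤ) := (box2 N).filter fun x ↦ 4 * x.1 ^ 2 + 4 * x.2 ^ 2 = (N : ℤ)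

/-- `k² ≤ N ⟹ k ∈ [-N, N]`. [folklore] -/
theorem mem_box2_of_sq_le {N : ℕ} {k : ℤ} (h : k ^ 2 ≤ (N : ℤ)) : k ∈ Finset.Icc (-(N : ℤ)) N := by
  rw [Finset.mem_Icc]
  constructor <;> nlinarith [sq_nonneg (k - 1), sq_nonneg (k + 1)]

/-- Membership in `dupL` is the equation. [folklore] -/
theorem mem_dupL {N : ℕ} {x : ℤ × ℤ} : x ∈ dupL N ↔ 8 * x.1 ^ 2 + 8 * x.2 ^ 2 = (N : ℤ) := by
  simp only [dupL, box2, Finset.mem_filter, Finset.mem_product, and_iff_right_iff_imp]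
  intro h
  exact ⟨mem_box2_of_sq_le (by nlinarith [sq_nonneg x.2]), mem_box2_of_sq_le (by nlinarith [sq_nonneg x.1])⟩

/-- Membership in `dupR` is the equation. [folklore] -/
theorem mem_dupR {N : ℕ} {x : ℤ × ℤ} : x ∈ dupR N ↔ 4 * x.1 ^ 2 + 4 * x.2 ^ 2 = (N : ℤ) := by
  simp only [dupR, box2, Finset.mem_filter, Finset.mem_product, and_iff_right_iff_imp]
  intro h
  exact ⟨mem_box2_of_sq_le (by nlinarith [sq_nonneg x.2]), mem_box2_of_sq_le (by nlinarith [sq_nonneg x.1])⟩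

/-- `(-1)^{|k|} (-1)^{|l|} = (-1)^{|b|}` when `k + l ≡ b (mod 2)`. [folklore] -/
theorem neg_one_pow_natAbs_mul_eq {k l b : ℤ} (h : (k + l) % 2 = b % 2) :
    (-1 : ℤ) ^ k.natAbs * (-1) ^ l.natAbs = (-1) ^ b.natAbs := by
  rw [neg_one_pow_eq_pow_mod_two (n := k.natAbs), neg_one_pow_eq_pow_mod_two (n := l.natAbs),
    neg_one_pow_eq_pow_mod_two (n := b.natAbs)]
  rcases Int.emod_two_eq_zero_or_one k with hk | hk <;>
  rcases Int.emod_two_eq_zero_or_one l with hl | hl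
  · rw [show k.natAbs % 2 = 0 by omega, show l.natAbs % 2 = 0 by omega, show b.natAbs % 2 = 0 by omega]; norm_num
  · rw [show k.natAbs % 2 = 0 by omega, show l.natAbs % 2 = 1 by omega, show b.natAbs % 2 = 1 by omega]; norm_num
  · rw [show k.natAbs % 2 = 1 by omega, show l.natAbs % 2 = 0 by omega, show b.natAbs % 2 = 1 by omega]; norm_num
  · rw [show k.natAbs % 2 = 1 by omega, show l.natAbs % 2 = 1 by omega, show b.natAbs % 2 = 0 by omega]; norm_num

/-- **The duplication identity, coefficientwise**: for every `N`,
`∑_{8k²+8l² = N} (-1)^{k+l} = ∑_{4a²+4b² = N} (-1)^b` — pairs `(a, b)` with `a ≢ b (2)` cancel under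
`(a,b) ↦ (b,a)`, and `(k,l) ↦ (k+l, k-l)` is a bijection onto the pairs with `a ≡ b (2)`
(this is `θ₄(2τ)² = θ₃(τ)θ₄(τ)` at `τ = 8z`). [folklore] -/
theorem sum_dupL_eq_sum_dupR (N : ℕ) :
    ∑ x ∈ dupL N, (-1 : ℤ) ^ x.1.natAbs * (-1) ^ x.2.natAbs = ∑ x ∈ dupR N, (-1 : ℤ) ^ x.2.natAbs := by
  classical
  rw [← Finset.sum_filter_add_sum_filter_not (dupR N) (fun x ↦ (x.1 + x.2) % 2 = 0)]
  -- the mixed-parity part cancels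
  have hodd : ∑ x ∈ (dupR N).filter (fun x ↦ ¬ (x.1 + x.2) % 2 = 0), (-1 : ℤ) ^ x.2.natAbs = 0 := by
    refine Finset.sum_involution (fun x _ ↦ (x.2, x.1)) ?_ ?_ ?_ ?_
    · intro x hx
      simp only [Finset.mem_filter] at hx
      exact neg_one_pow_natAbs_add_eq_zero (n := x.1) (k := x.2) (by omega)
    · intro x hx _ heq
      simp only [Finset.mem_filter] at hx
      have h1 : x.2 = x.1 := congrArg Prod.fst heq
      omega
    · intro x hx
      simp only [Finset.mem_filter, mem_dupR] at hx ⊢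
      exact ⟨by linarith [hx.1], by omega⟩
    · intro x _
      rfl
  rw [hodd, add_zero]
  -- the even part: bijection with `dupL`
  symm
  refine Finset.sum_nbij' (fun x ↦ ((x.1 + x.2) / 2, (x.1 - x.2) / 2)) (fun y ↦ (y.1 + y.2, y.1 - y.2))
    ?_ ?_ ?_ ?_ ?_
  · intro x hx
    simp only [Finset.mem_filter, mem_dupR] at hx
    rw [mem_dupL]
    obtain ⟨h1, h2⟩ := hx
    have ha : (x.1 + x.2) % 2 = 0 := h2
    have e1 : 2 * ((x.1 + x.2) / 2) = x.1 + x.2 := by omega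
    have e2 : 2 * ((x.1 - x.2) / 2) = x.1 - x.2 := by omega
    show 8 * ((x.1 + x.2) / 2) ^ 2 + 8 * ((x.1 - x.2) / 2) ^ 2 = (N : ℤ)
    calc 8 * ((x.1 + x.2) / 2) ^ 2 + 8 * ((x.1 - x.2) / 2) ^ 2
        = 2 * (2 * ((x.1 + x.2) / 2)) ^ 2 + 2 * (2 * ((x.1 - x.2) / 2)) ^ 2 := by ring
      _ = 2 * (x.1 + x.2) ^ 2 + 2 * (x.1 - x.2) ^ 2 := by rw [e1, e2]
      _ = (N : ℤ) := by linear_combination h1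
  · intro y hy
    rw [mem_dupL] at hy
    simp only [Finset.mem_filter, mem_dupR]
    refine ⟨by nlinarith [hy], by omega⟩
  · intro x hx
    simp only [Finset.mem_filter] at hx
    have ha : (x.1 + x.2) % 2 = 0 := hx.2
    ext <;> simp only <;> omega
  · intro y _
    ext <;> simp only <;> omega
  · intro x hx
    simp only [Finset.mem_filter] at hx
    have ha : (x.1 + x.2) % 2 = 0 := hx.2
    show (-1 : ℤ) ^ x.2.natAbs = (-1) ^ ((x.1 + x.2) / 2).natAbs * (-1) ^ ((x.1 - x.2) / 2).natAbs
    refine (neg_one_pow_natAbs_mul_eq ?_).symm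
    have e : (x.1 + x.2) / 2 + (x.1 - x.2) / 2 = x.1 := by omega
    rw [e]
    omega

/-! ### `q`-series of the theta factors -/

section QSeries2

variable (z : ℍ)

/-- `thetaTerm t z n = q^{t n²}`. [folklore] -/
theorem thetaTerm_eq_qParam_pow (t : ℕ) (n : ℤ) :
    thetaTerm t z n = Periodic.qParam 1 z ^ ((t : ℤ) * n ^ 2).toNat := by
  rw [thetaTerm, ← cexp_two_pi_I_natCast]
  congr 1
  have h : ((((t : ℤ) * n ^ 2).toNat : ℕ) : ℂ) = (((t : ℤ) * n ^ 2 : ℤ) : ℂ) := by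
    have : ((((t : ℤ) * n ^ 2).toNat : ℕ) : ℤ) = (t : ℤ) * n ^ 2 := Int.toNat_of_nonneg (by positivity)
    exact_mod_cast this
  rw [h]

/-- The terms `(-1)^k q^{8k²}` of `2θ₃₂ - θ₈ = θ₄(16z)`. [folklore] -/
def termE (k : ℤ) : ℂ := (-1 : ℂ) ^ k.natAbs * Periodic.qParam 1 z ^ (8 * k ^ 2).toNat

/-- **`2θ₃₂ - θ₈ = ∑ (-1)^k q^{8k²}`** (the tree's `tsum_neg_one_pow_mul_thetaTerm`). [folklore] -/
theorem hasSum_termE : HasSum (termE z) (2 * thetaMul 32 z - thetaMul 8 z) := by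
  have hs : Summable (fun n : ℤ ↦ (-1 : ℂ) ^ n.natAbs * thetaTerm 8 z n) :=
    (summable_norm_neg_one_pow_mul_thetaTerm z).of_norm
  have h := hs.hasSum
  rw [tsum_neg_one_pow_mul_thetaTerm] at h
  refine h.congr_fun fun n ↦ ?_
  rw [termE, thetaTerm_eq_qParam_pow]
  push_cast
  ring_nf

/-- Summability of `∑ ‖termE‖`. [folklore] -/
theorem summable_norm_termE : Summable (fun n : ℤ ↦ ‖termE z n‖) := by
  refine (summable_norm_neg_one_pow_mul_thetaTerm z).congr fun n ↦ ?_
  rw [termE, thetaTerm_eq_qParam_pow]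
  push_cast
  ring_nf

/-- `θ₃(8z) = θ₄` (`∑ q^{4n²} = θ(4z)`). [folklore] -/
theorem theta3_eight_eq_thetaMul_four : theta3 (8 * (z : ℂ)) = thetaMul 4 z := by
  refine (hasSum_theta3_eight z).unique ((hasSum_thetaTerm 4 (by norm_num) z).congr_fun fun n ↦ ?_)
  rw [termB, thetaTerm_eq_qParam_pow]
  push_cast
  ring_nf

/-- `θ₂(8z) = θ₁ - θ₄` (`∑_{n ∈ ℤ} q^{(2n+1)²} = ∑_{x odd} q^{x²}`). [folklore] -/
theorem theta2_eight_eq_one_sub_four : theta2 (8 * (z : ℂ)) = thetaMul 1 z - thetaMul 4 z := by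
  rw [thetaMul_one_eq, add_sub_cancel_left]
  have hi21 : Function.Injective (fun k : ℤ ↦ 2 * k + 1) :=
    (add_left_injective 1).comp (mul_right_injective₀ two_ne_zero)
  have ho : HasSum (fun j : ℤ ↦ thetaTerm 1 z (2 * j + 1)) (∑' j : ℤ, thetaTerm 1 z (2 * j + 1)) :=
    ((hasSum_thetaTerm 1 one_pos z).summable.comp_injective hi21).hasSum
  refine (hasSum_theta2_eight z).unique (ho.congr_fun fun n ↦ ?_)
  rw [termA, thetaTerm_eq_qParam_pow]
  push_cast
  ring_nf

/-! ### The duplication identity and `2gθ₃₂ - gθ₈ = ½ θ₁'(8z)` -/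

/-- Regrouping a `q`-series over `ℤ × ℤ` by the exponent. [folklore] -/
theorem hasSum_nat_of_hasSum_int2 {a : ℤ × ℤ → ℂ} {E : ℤ × ℤ → ℤ} {S : ℂ} (hE : ∀ x, 0 ≤ E x)
    (hbox : ∀ x (N : ℕ), E x = N → x ∈ box2 N)
    (h : HasSum (fun x ↦ a x * Periodic.qParam 1 z ^ (E x).toNat) S) :
    HasSum (fun N : ℕ ↦ (∑ x ∈ box2 N, if E x = N then a x else 0) * Periodic.qParam 1 z ^ N) S := by
  classical
  set F : ℤ × ℤ → ℕ := fun x ↦ (E x).toNat with hF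
  have hfib : ∀ x (N : ℕ), x ∈ F ⁻¹' {N} ↔ E x = N := fun x N ↦ by
    simp only [Set.mem_preimage, Set.mem_singleton_iff, hF]
    constructor
    · intro h'; rw [← Int.toNat_of_nonneg (hE x), h']
    · intro h'; rw [h', Int.toNat_natCast]
  have h' := h.tsum_fiberwise F
  refine h'.congr_fun fun N ↦ ?_
  symm
  rw [_root_.tsum_subtype (F ⁻¹' {N}) (fun x ↦ a x * Periodic.qParam 1 z ^ (E x).toNat),
    tsum_eq_sum (s := box2 N)]
  · rw [Finset.sum_mul]
    refine Finset.sum_congr rfl fun x _ ↦ ?_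
    rw [Set.indicator_apply]
    by_cases hx : E x = N
    · rw [if_pos ((hfib x N).mpr hx), if_pos hx, hx, Int.toNat_natCast]
    · rw [if_neg (fun h'' ↦ hx ((hfib x N).mp h'')), if_neg hx, zero_mul]
  · intro x hx
    rw [Set.indicator_of_notMem]
    intro hmem
    exact hx (hbox x N ((hfib x N).mp hmem))

/-- **Duplication: `(2θ₃₂ - θ₈)² = θ₃(8z) θ₄(8z)`** (`θ₄(2τ)² = θ₃(τ)θ₄(τ)` at `τ = 8z`), from the
coefficient identity `sum_dupL_eq_sum_dupR`. [folklore] -/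
theorem sq_two_thirtytwo_sub_eight :
    (2 * thetaMul 32 z - thetaMul 8 z) ^ 2 = theta3 (8 * (z : ℂ)) * theta4 (8 * (z : ℂ)) := by
  classical
  -- the two double series
  have hL : HasSum (fun x : ℤ × ℤ ↦ termE z x.1 * termE z x.2) ((2 * thetaMul 32 z - thetaMul 8 z) ^ 2) := by
    rw [sq]
    exact (hasSum_termE z).mul (hasSum_termE z)
      (summable_mul_of_summable_norm (summable_norm_termE z) (summable_norm_termE z))
  have hR : HasSum (fun x : ℤ × ℤ ↦ termB z x.1 * termC z x.2) (theta3 (8 * (z : ℂ)) * theta4 (8 * (z : ℂ))) :=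
    (hasSum_theta3_eight z).mul (hasSum_theta4_eight z)
      (summable_mul_of_summable_norm (summable_norm_termB z) (summable_norm_termC z))
  -- regroup both by the exponent
  have hL' := hasSum_nat_of_hasSum_int2 z (a := fun x : ℤ × ℤ ↦ (-1 : ℂ) ^ x.1.natAbs * (-1) ^ x.2.natAbs)
    (E := fun x ↦ 8 * x.1 ^ 2 + 8 * x.2 ^ 2) (fun x ↦ by positivity)
    (fun x N hx ↦ (Finset.mem_filter.mp (mem_dupL.mpr hx)).1) (hL.congr_fun fun x ↦ by
      simp only [termE]
      rw [Int.toNat_add (by positivity) (by positivity), pow_add]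
      ring)
  have hR' := hasSum_nat_of_hasSum_int2 z (a := fun x : ℤ × ℤ ↦ (-1 : ℂ) ^ x.2.natAbs)
    (E := fun x ↦ 4 * x.1 ^ 2 + 4 * x.2 ^ 2) (fun x ↦ by positivity)
    (fun x N hx ↦ (Finset.mem_filter.mp (mem_dupR.mpr hx)).1) (hR.congr_fun fun x ↦ by
      simp only [termB, termC]
      rw [Int.toNat_add (by positivity) (by positivity), pow_add]
      ring)
  -- the coefficients agree
  have hcoef : (fun N : ℕ ↦ (∑ x ∈ box2 N, if 8 * x.1 ^ 2 + 8 * x.2 ^ 2 = (N : ℤ) then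
      (-1 : ℂ) ^ x.1.natAbs * (-1) ^ x.2.natAbs else 0) * Periodic.qParam 1 z ^ N) =
      (fun N : ℕ ↦ (∑ x ∈ box2 N, if 4 * x.1 ^ 2 + 4 * x.2 ^ 2 = (N : ℤ) then
      (-1 : ℂ) ^ x.2.natAbs else 0) * Periodic.qParam 1 z ^ N) := by
    funext N
    congr 1
    have h := congrArg (fun t : ℤ ↦ (t : ℂ)) (sum_dupL_eq_sum_dupR N)
    simp only [dupL, dupR, Finset.sum_filter] at h
    push_cast at h
    convert h using 2
  rw [hcoef] at hL'
  exact hL'.unique hR'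

/-- **`2gθ₃₂ - gθ₈ = ½ θ₁'(8z)`** (`= η(8z)³ = ∑ χ₋₄(m) m q^{m²}`, Tunnell's remark p. 327): by
`2g = (θ₁ - θ₄)(2θ₃₂ - θ₈)` (tree), the duplication identity and Jacobi's `θ₁' = θ₂θ₃θ₄` (tree).
[cite: Tunnell1983Congruent, p. 327] -/
theorem two_thirtytwo_sub_eight_eq_half_theta1' :
    2 * tunnellForm 32 z - tunnellForm 8 z = (1 / 2 : ℂ) * theta1' (8 * (z : ℂ)) := by
  have hg := two_mul_tunnellG_eq z
  have h2 : 2 * tunnellForm 32 z - tunnellForm 8 z = tunnellG z * (2 * thetaMul 32 z - thetaMul 8 z) := by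
    simp only [tunnellForm]; ring
  rw [h2, jacobi_derivative_formula, theta2_eight_eq_one_sub_four, mul_assoc (thetaMul 1 z - thetaMul 4 z),
    ← sq_two_thirtytwo_sub_eight]
  have : tunnellG z = (1 / 2 : ℂ) * ((thetaMul 1 z - thetaMul 4 z) * (2 * thetaMul 32 z - thetaMul 8 z)) := by
    rw [← hg]; ring
  rw [this]
  ring

end QSeries2

/-! ### The form `φ = (2gθ₃₂ - gθ₈)(2θ₁₆ - θ₄) = ½ θ₁'(8z) θ₄(8z)` -/

section Phi

variable (z : ℍ)

/-- `e^{2πi 4(2j)² z} = e^{2πi 16j² z}`. [folklore] -/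
private theorem thetaTerm_four_two_mul_aux (j : ℤ) : thetaTerm 4 z (2 * j) = thetaTerm 16 z j := by
  unfold thetaTerm
  congr 1
  push_cast
  ring

/-- **`θ₄(8z) = 2θ₁₆ - θ₄`** (`∑ (-1)ⁿ q^{4n²} = 2θ(16z) - θ(4z)`). [folklore] -/
theorem theta4_eight_eq : theta4 (8 * (z : ℂ)) = 2 * thetaMul 16 z - thetaMul 4 z := by
  have hi21 : Function.Injective (fun k : ℤ ↦ 2 * k + 1) :=
    (add_left_injective 1).comp (mul_right_injective₀ two_ne_zero)
  have h4 := hasSum_thetaTerm 4 (by norm_num) z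
  set O₄ := ∑' j : ℤ, thetaTerm 4 z (2 * j + 1) with hO₄
  have he : HasSum (fun j : ℤ ↦ thetaTerm 4 z (2 * j)) (thetaMul 16 z) :=
    (hasSum_thetaTerm 16 (by norm_num) z).congr_fun fun j ↦ thetaTerm_four_two_mul_aux z j
  have ho : HasSum (fun j : ℤ ↦ thetaTerm 4 z (2 * j + 1)) O₄ := (h4.summable.comp_injective hi21).hasSum
  have hθ4 : thetaMul 4 z = thetaMul 16 z + O₄ := h4.unique (hasSum_int_even_add_odd he ho)
  -- the signed series: even terms `+`, odd terms `-`
  have hs : HasSum (fun n : ℤ ↦ (-1 : ℂ) ^ n.natAbs * thetaTerm 4 z n) (thetaMul 16 z + -O₄) := by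
    refine hasSum_int_even_add_odd (f := fun n : ℤ ↦ (-1 : ℂ) ^ n.natAbs * thetaTerm 4 z n) ?_ ?_
    · refine he.congr_fun fun j ↦ ?_
      show (-1 : ℂ) ^ (2 * j).natAbs * thetaTerm 4 z (2 * j) = thetaTerm 4 z (2 * j)
      rw [show (2 * j).natAbs = 2 * j.natAbs by rw [Int.natAbs_mul]; rfl, pow_mul]
      norm_num
    · refine (ho.neg).congr_fun fun j ↦ ?_
      show (-1 : ℂ) ^ (2 * j + 1).natAbs * thetaTerm 4 z (2 * j + 1) = -thetaTerm 4 z (2 * j + 1)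
      have : (-1 : ℂ) ^ (2 * j + 1).natAbs = -1 := by
        rw [neg_one_pow_eq_pow_mod_two (n := (2 * j + 1).natAbs), show (2 * j + 1).natAbs % 2 = 1 by omega]
        norm_num
      rw [this]
      ring
  refine (hasSum_theta4_eight z).unique (hs.congr_fun fun n ↦ ?_) |>.trans (by rw [hθ4]; ring)
  rw [termC, thetaTerm_eq_qParam_pow]
  push_cast
  ring_nf

/-- **The congruent-number newform at level `128`**: `φ = (2gθ₃₂ - gθ₈)·(2θ₁₆ - θ₄)`
(`= η(4z)² η(8z)²`, the newform of `y² = x³ - x` of level `32`, viewed at level `128`).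
[cite: Tunnell1983Congruent, p. 325 (`φ`) and p. 327] -/
def congruentPhi (z : ℍ) : ℂ :=
  (2 * tunnellForm 32 z - tunnellForm 8 z) * (2 * thetaMul 16 z - thetaMul 4 z)

/-- `φ = ½ θ₁'(8z) θ₄(8z)`. [folklore] -/
theorem congruentPhi_eq_half_theta1'_mul_theta4 :
    congruentPhi z = (1 / 2 : ℂ) * theta1' (8 * (z : ℂ)) * theta4 (8 * (z : ℂ)) := by
  rw [congruentPhi, two_thirtytwo_sub_eight_eq_half_theta1', theta4_eight_eq]

/-- `2gθ₃₂ - gθ₈ ∈ S_{3/2}(128, 1)`. [folklore] -/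
theorem two_thirtytwo_sub_eight_mem :
    (fun z : ℍ ↦ 2 * tunnellForm 32 z - tunnellForm 8 z) ∈ halfIntCuspForms 3 128 1 := by
  have h : (fun z : ℍ ↦ 2 * tunnellForm 32 z - tunnellForm 8 z) = (2 : ℂ) • tunnellForm 32 - tunnellForm 8 := by
    funext w; simp [smul_eq_mul]
  rw [h]
  exact Submodule.sub_mem _ (Submodule.smul_mem _ _ tunnellForm_thirtytwo_mem_halfIntCuspForms)
    tunnellForm_eight_mem_halfIntCuspForms

/-- **`φ ∈ S_{4/2}(128, 1) = S₂(Γ₀(128))`.** [cite: Tunnell1983Congruent, p. 327] -/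
theorem congruentPhi_mem : congruentPhi ∈ halfIntCuspForms 4 128 1 := by
  have h16 := mul_thetaMul_mem_of_mem_triv two_thirtytwo_sub_eight_mem (t := 16) (Or.inr (Or.inr rfl))
  have h4 := mul_thetaMul_mem_of_mem_triv two_thirtytwo_sub_eight_mem (t := 4) (Or.inr (Or.inl rfl))
  have h : congruentPhi = (2 : ℂ) • ((fun z : ℍ ↦ 2 * tunnellForm 32 z - tunnellForm 8 z) * thetaMul 16) -
      (fun z : ℍ ↦ 2 * tunnellForm 32 z - tunnellForm 8 z) * thetaMul 4 := by
    funext w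
    simp only [congruentPhi, Pi.sub_apply, Pi.smul_apply, Pi.mul_apply, smul_eq_mul]
    ring
  rw [h]
  exact Submodule.sub_mem _ (Submodule.smul_mem _ _ h16) h4

/-! ### The `q`-expansion of `φ`: `a_N(φ) = Re S(N) = a_N(E)` -/

/-- Summability of `∑ ‖(-1)ⁿ (2n+1) q^{(2n+1)²}‖`. [folklore] -/
theorem summable_norm_termD : Summable (fun n : ℤ ↦ ‖termD z n‖) := by
  set c : ℝ := 2 * Real.pi * z.im with hc
  have hcpos : 0 < c := by positivity
  have hsum : Summable (fun n : ℤ ↦ 2 * Real.exp (-c * n ^ 2) + 2 / c * Real.exp (-(c / 2) * n ^ 2)) :=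
    ((summable_exp_neg_mul_sq hcpos).mul_left 2).add ((summable_exp_neg_mul_sq (half_pos hcpos)).mul_left _)
  refine Summable.of_nonneg_of_le (fun _ ↦ norm_nonneg _) (fun n ↦ ?_) hsum
  rw [termD, norm_mul, norm_mul, norm_pow, norm_neg, norm_one, one_pow, one_mul,
    norm_qParam_pow_toNat z (sq_nonneg _)]
  have hn : ‖(2 * (n : ℂ) + 1)‖ = |(2 * (n : ℝ) + 1)| := by
    rw [show (2 * (n : ℂ) + 1) = ((2 * (n : ℝ) + 1 : ℝ) : ℂ) by push_cast; ring, Complex.norm_real,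
      Real.norm_eq_abs]
  rw [hn]
  push_cast
  -- `|2n+1| e^{-c(2n+1)²} ≤ (n² + 2) e^{-c n²} ≤ 2 e^{-cn²} + (2/c) e^{-(c/2) n²}`
  have h1 : |(2 * (n : ℝ) + 1)| ≤ (n : ℝ) ^ 2 + 2 := by
    rw [abs_le]; constructor <;> nlinarith [sq_nonneg ((n : ℝ) + 1), sq_nonneg ((n : ℝ) - 1)]
  have h2 : Real.exp (-c * (2 * (n : ℝ) + 1) ^ 2) ≤ Real.exp (-c * n ^ 2) := by
    rw [Real.exp_le_exp]
    have : (n : ℝ) ^ 2 ≤ (2 * n + 1) ^ 2 := by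
      have hi : (n : ℤ) ^ 2 ≤ (2 * n + 1) ^ 2 := by
        rcases le_or_gt 0 n with h | h
        · nlinarith
        · have h1' : 0 ≤ -n - 1 := by omega
          have h2' : 0 ≤ -3 * n - 1 := by omega
          nlinarith [mul_nonneg h1' h2']
      exact_mod_cast hi
    nlinarith
  have h3 : (n : ℝ) ^ 2 * Real.exp (-c * n ^ 2) ≤ 2 / c * Real.exp (-(c / 2) * n ^ 2) := by
    have hlin : c / 2 * (n : ℝ) ^ 2 ≤ Real.exp (c / 2 * n ^ 2) := by
      have := Real.add_one_le_exp (c / 2 * (n : ℝ) ^ 2); linarith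
    have hsplit : Real.exp (-c * (n : ℝ) ^ 2) = Real.exp (-(c / 2) * n ^ 2) * Real.exp (-(c / 2) * n ^ 2) := by
      rw [← Real.exp_add]; ring_nf
    have hA : (n : ℝ) ^ 2 * Real.exp (-(c / 2) * n ^ 2) ≤ 2 / c := by
      rw [show -(c / 2) * (n : ℝ) ^ 2 = -(c / 2 * n ^ 2) by ring, Real.exp_neg, ← div_eq_mul_inv,
        div_le_div_iff₀ (Real.exp_pos _) hcpos]
      nlinarith [hlin]
    calc (n : ℝ) ^ 2 * Real.exp (-c * n ^ 2)
        = ((n : ℝ) ^ 2 * Real.exp (-(c / 2) * n ^ 2)) * Real.exp (-(c / 2) * n ^ 2) := by rw [hsplit]; ring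
      _ ≤ 2 / c * Real.exp (-(c / 2) * n ^ 2) := mul_le_mul_of_nonneg_right hA (Real.exp_pos _).le
  have hexp0 : 0 ≤ Real.exp (-c * (n : ℝ) ^ 2) := (Real.exp_pos _).le
  calc |(2 * (n : ℝ) + 1)| * Real.exp (-(2 * Real.pi * z.im) * ((2 * n + 1) ^ 2))
      = |(2 * (n : ℝ) + 1)| * Real.exp (-c * (2 * n + 1) ^ 2) := by rw [hc]
    _ ≤ ((n : ℝ) ^ 2 + 2) * Real.exp (-c * n ^ 2) := by
        apply mul_le_mul h1 h2 (Real.exp_pos _).le (by positivity)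
    _ = 2 * Real.exp (-c * n ^ 2) + (n : ℝ) ^ 2 * Real.exp (-c * n ^ 2) := by ring
    _ ≤ 2 * Real.exp (-c * n ^ 2) + 2 / c * Real.exp (-(c / 2) * n ^ 2) := by linarith

/-- The double series of `φ`: `φ(z) = ½ ∑_{(n,b)} (-1)^{n+b} (2n+1) q^{(2n+1)² + 4b²}`. [folklore] -/
theorem hasSum_congruentPhi_pairs :
    HasSum (fun x : ℤ × ℤ ↦ ((1 / 2 : ℂ) * ((-1 : ℂ) ^ x.1.natAbs * (2 * x.1 + 1) * (-1) ^ x.2.natAbs)) *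
        Periodic.qParam 1 z ^ ((2 * x.1 + 1) ^ 2 + 4 * x.2 ^ 2).toNat) (congruentPhi z) := by
  have h := ((hasSum_theta1'_eight z).mul (hasSum_theta4_eight z)
    (summable_mul_of_summable_norm (summable_norm_termD z) (summable_norm_termC z))).mul_left (1 / 2 : ℂ)
  rw [congruentPhi_eq_half_theta1'_mul_theta4, mul_assoc]
  refine h.congr_fun fun x ↦ ?_
  simp only [termD, termC]
  rw [Int.toNat_add (sq_nonneg _) (by positivity), pow_add]
  ring

/-- **The `q`-expansion of `φ`**: `a_N(φ) = ½ ∑_{(2n+1)² + 4b² = N} (-1)^{n+b} (2n+1) = Re S(N)`,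
`S(N) = ∑_{x primary, N x = N} x` (the tree's `pairSum_eq_two_mul_re_primarySum`).
[cite: Tunnell1983Congruent, p. 325] -/
theorem hasSum_congruentPhi :
    HasSum (fun N : ℕ ↦ ((QuadraticFields.GaussianPrimary.primarySum N).re : ℂ) *
      Periodic.qParam 1 z ^ N) (congruentPhi z) := by
  classical
  have h := hasSum_nat_of_hasSum_int2 z
    (a := fun x : ℤ × ℤ ↦ (1 / 2 : ℂ) * ((-1 : ℂ) ^ x.1.natAbs * (2 * x.1 + 1) * (-1) ^ x.2.natAbs))
    (E := fun x ↦ (2 * x.1 + 1) ^ 2 + 4 * x.2 ^ 2) (fun x ↦ by positivity)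
    (fun x N hx ↦ (Finset.mem_filter.mp (mem_pairSet.mpr hx)).1) (hasSum_congruentPhi_pairs z)
  refine h.congr_fun fun N ↦ ?_
  congr 1
  have hpair := congrArg (fun t : ℤ ↦ (t : ℂ)) (pairSum_eq_two_mul_re_primarySum N)
  simp only [pairSet, Finset.sum_filter] at hpair
  push_cast at hpair
  -- `∑ box ite = ½ · (∑ pairSet …) = ½ · 2 Re S`
  have : (∑ x ∈ box2 N, if (2 * x.1 + 1) ^ 2 + 4 * x.2 ^ 2 = (N : ℤ) then
      (1 / 2 : ℂ) * ((-1 : ℂ) ^ x.1.natAbs * (2 * x.1 + 1) * (-1) ^ x.2.natAbs) else 0) =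
      (1 / 2 : ℂ) * ∑ x ∈ box2 N, (if (2 * x.1 + 1) ^ 2 + 4 * x.2 ^ 2 = (N : ℤ) then
        ((-1 : ℂ) ^ x.1.natAbs * (-1) ^ x.2.natAbs * (2 * x.1 + 1)) else 0) := by
    rw [Finset.mul_sum]
    refine Finset.sum_congr rfl fun x _ ↦ ?_
    split_ifs <;> ring
  rw [this, show box2 N = Finset.Icc (-(N : ℤ)) N ×ˢ Finset.Icc (-(N : ℤ)) N from rfl, hpair]
  ring

/-- **The `q`-expansion coefficients of `φ` are `Re S(N)`.** [cite: Tunnell1983Congruent, p. 325] -/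
theorem qCoeffs_congruentPhi :
    qCoeffs congruentPhi = fun N ↦ ((QuadraticFields.GaussianPrimary.primarySum N).re : ℂ) :=
  qCoeffs_eq_of_hasSum fun z ↦ hasSum_congruentPhi z

end Phi

/-! ### `a_N(φ) = a_N(E)`: the bridge to the congruent number curve -/

/-- **`a_N(φ) = a_N(E)` for all `N ≥ 1`**, `E = congruentNumberCurve 1 : y² = x³ - x` — the modularity
of `E` in explicit form: `a_N(E) = Re S(N)` by the tree's
`lFunction_congruentNumberCurve_eq_jacobiSym_mul_primarySum` (Ireland–Rosen 18.5, proved) with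
`n = 1`. [cite: Tunnell1983Congruent, p. 325 ("the Mellin transform of `φ` is `L(E, s)`")] -/
theorem qCoeffs_congruentPhi_eq_lFunction {N : ℕ} (hN : N ≠ 0) :
    qCoeffs congruentPhi N = ((congruentNumberCurve 1).LFunction N : ℂ) := by
  rw [qCoeffs_congruentPhi]
  have h := lFunction_congruentNumberCurve_eq_jacobiSym_mul_primarySum (n := 1) squarefree_one
    IrelandRosen1990_card_points_one_mod_four_holds hN
  rw [Nat.cast_one, jacobiSym.one_left, Int.cast_one, one_mul] at h
  have hre := congrArg Zsqrtd.re h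
  rw [Zsqrtd.re_intCast] at hre
  show ((QuadraticFields.GaussianPrimary.primarySum N).re : ℂ) = _
  rw [← hre]

/-- **`a_N(E_n) = (n/N) · a_N(φ)`** for square-free `n` and `N ≥ 1`: the quadratic twists of `E` are
the twists of `φ` by the Jacobi symbol `(n/·)`. [cite: Tunnell1983Congruent, p. 325
("`L(Eᴰ, s)` is the Mellin transform of `φ ⊗ χ_D`")] -/
theorem lFunction_congruentNumberCurve_eq_jacobiSym_mul_qCoeffs {n : ℕ} (hn : Squarefree n)
    {N : ℕ} (hN : N ≠ 0) :
    ((congruentNumberCurve n).LFunction N : ℂ) = (jacobiSym n N : ℂ) * qCoeffs congruentPhi N := by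
  rw [qCoeffs_congruentPhi]
  have h := lFunction_congruentNumberCurve_eq_jacobiSym_mul_primarySum (n := n) hn
    IrelandRosen1990_card_points_one_mod_four_holds hN
  have hre := congrArg Zsqrtd.re h
  rw [Zsqrtd.re_intCast, Zsqrtd.re_mul, Zsqrtd.re_intCast, Zsqrtd.im_intCast] at hre
  simp only [zero_mul, mul_zero, add_zero] at hre
  show _ = (jacobiSym n N : ℂ) * ((QuadraticFields.GaussianPrimary.primarySum N).re : ℂ)
  exact_mod_cast hre

end Literature.NumberTheory.EllipticCurves.Tunnell1983

end
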